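import Literature.NumberTheory.Sieve.FordAsymptoticSieveLambdaK
import Literature.NumberTheory.LFunctions.PrimeNumberTheoremErrorTermProofs
import HarnessLib

/-!
# Ford's counterexamples to a fixed-level asymptotic sieve: the local construction holds

Topic `Literature/NumberTheory/Sieve`. This file DISCHARGES the named fact
`Literature.NumberTheory.Sieve.Ford2004_localConstruction` of `FordAsymptoticSieve.lean`
([Ford2004] Theorem 3 with the choice of `f_{1_M}` of the proof of Theorem 1, i.e. (2.3)–(2.5) on
one interval `I = (x, x + x e^{−c₁√log x}]`): `Ford2004_localConstruction_holds`. Source: K. Ford,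
*On Bombieri's asymptotic sieve*, Trans. Amer. Math. Soc. **357** (2005) 1663–1674
(arXiv math/0401215) [Ford2004], §§2–3.

The proof assembles the chain of PROVED files
`FordAsymptoticSieveCombinatorics` / `…ExpAlgebra` (the exponential-formula identities (3.9)–(3.10),
(3.13)–(3.14)), `Literature/Analysis/Convolution/CompactlySupportedConvolutionAlgebra` (the
convolution algebra in which they are instantiated), `…PrimeSums` / `…Lemma22` (Lemma 2.2 from the
prime number theorem with the de la Vallée Poussin error term), `…Tuples` / `…TypeI` (the
construction `B(n)` for the PRODUCT choice `f_{1_M}(u) = ∏ u_i Φ(u_i)` and (2.4)) and `…LambdaK`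
((2.5) via the generating function `μ ⋆ n^{z/log x}` and Cauchy's estimate), with:

* a concrete bump: the tent `Φ(t) = (1/(4M)) max(0, 1 − 4M²|t − 1/M|)` (`Ford2004.tent`,
  `Ford2004.tentBump M : Bump` for `M ≥ 2`);
* the choice of parameters from `ν`: `M = ⌈4/(1−ν)⌉ + 2` (`exists_M`: `1/M + 1/(4M²) < 1 − ν`),
  `ϖ` strictly between `1/M + w` and `1 − ν` ((2.1)), `c₁ = c√ε/4` with `c` from the tree's PROVED
  `Literature.NumberTheory.LFunctions.ChebyshevThetaDeLaValleePoussin_holds` (Lemma 2.1),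
  `θ_k = Z_k > 0`, and `a_n = 1 + σ(−1)^{M+1} Re B(n) ∈ [0, 2]` ((2.3), from `|B(n)| ≤ 1`);
* the window bookkeeping `K = |I ∩ ℤ| = xη + O(1)`, `#{n ∈ I : d ∣ n} = K/d + O(1)`
  (`abs_card_sub_le`, `abs_card_multiples_sub_le`, `window_facts`) turning
  `Bump.typeI_bound` into (2.4) (`Bump.typeI_final`) and `Bump.lambdaK_est` into (2.5)
  (`Bump.lambda_final`).

Everything here is PROVED; the only definitions are the explicit tent data. With this file the
barrier `Literature.Barriers.Parity.FordFixedLevelBarrier` ([Ford2004] Theorem 1) follows from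
the tree's `FordFixedLevelBarrier_of_localConstruction` (`FordFixedLevelProofs.lean`).

## References

* K. Ford, *On Bombieri's asymptotic sieve*, Trans. AMS 357 (2005), 1663–1674, §2 (2.1)–(2.5),
  Lemma 2.1, §3 Theorem 3 and the proof of Theorem 1 [Ford2004].
-/

noncomputable section

open Finset Real MeasureTheory Literature.Analysis.Convolution
open scoped Chebyshev

namespace Literature.NumberTheory.Sieve

namespace Ford2004

/-! ### A concrete bump: the tent of height `1/(4M)` and half-width `1/(4M²)` at `1/M` -/

/-- The tent `Φ(t) = (1/(4M)) max(0, 1 − |t − 1/M| · 4M²)`. [folklore] -/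
def tent (M : ℕ) (t : ℝ) : ℝ :=
  (1 / (4 * (M : ℝ))) * max 0 (1 - |t - 1 / M| / (1 / (4 * (M : ℝ) ^ 2)))

/-- The tent is non-negative. [folklore] -/
theorem tent_nonneg (M : ℕ) (t : ℝ) : 0 ≤ tent M t := by
  rw [tent]; exact mul_nonneg (by positivity) (le_max_left _ _)

/-- The tent is at most `1/(4M)`. [folklore] -/
theorem tent_le (M : ℕ) (t : ℝ) : tent M t ≤ 1 / (4 * (M : ℝ)) := by
  rw [tent]
  refine mul_le_of_le_one_right (by positivity) (max_le zero_le_one ?_)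
  have : 0 ≤ |t - 1 / M| / (1 / (4 * (M : ℝ) ^ 2)) := by positivity
  linarith

/-- The tent has height `1/(4M)` at `1/M`. [folklore] -/
theorem tent_center (M : ℕ) : tent M (1 / M) = 1 / (4 * (M : ℝ)) := by
  rw [tent, sub_self, abs_zero, zero_div, sub_zero, max_eq_right zero_le_one, mul_one]

/-- The tent vanishes outside `[1/M − 1/(4M²), 1/M + 1/(4M²)]`. [folklore] -/
theorem tent_eq_zero {M : ℕ} (hM : 0 < M) {t : ℝ}
    (ht : t < 1 / M - 1 / (4 * (M : ℝ) ^ 2) ∨ 1 / M + 1 / (4 * (M : ℝ) ^ 2) < t) : tent M t = 0 := by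
  rw [tent]
  have hw : 0 < 1 / (4 * (M : ℝ) ^ 2) := by positivity
  have habs : 1 / (4 * (M : ℝ) ^ 2) < |t - 1 / M| := by
    rcases ht with ht | ht
    · rw [abs_sub_comm, abs_of_pos (by linarith)]; linarith
    · rw [abs_of_pos (by linarith)]; linarith
  have : 1 - |t - 1 / M| / (1 / (4 * (M : ℝ) ^ 2)) < 0 := by
    rw [sub_neg, one_lt_div hw]; exact habs
  rw [max_eq_left this.le, mul_zero]

/-- The support of the tent is in `[1/M − 1/(4M²), 1/M + 1/(4M²)]`. [folklore] -/
theorem tent_supp {M : ℕ} (hM : 0 < M) {t : ℝ} (ht : tent M t ≠ 0) :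
    1 / M - 1 / (4 * (M : ℝ) ^ 2) ≤ t ∧ t ≤ 1 / M + 1 / (4 * (M : ℝ) ^ 2) := by
  by_contra h
  rw [not_and_or, not_le, not_le] at h
  exact ht (tent_eq_zero hM h)

/-- The tent is `M`-Lipschitz. [folklore] -/
theorem tent_lip (M : ℕ) (t t' : ℝ) : |tent M t - tent M t'| ≤ M * |t - t'| := by
  rcases Nat.eq_zero_or_pos M with rfl | hM
  · simp [tent]
  have hM' : (0 : ℝ) < M := by exact_mod_cast hM
  rw [tent, tent, ← mul_sub, abs_mul, abs_of_nonneg (by positivity)]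
  have h1 : |max 0 (1 - |t - 1 / M| / (1 / (4 * (M : ℝ) ^ 2))) -
      max 0 (1 - |t' - 1 / M| / (1 / (4 * (M : ℝ) ^ 2)))| ≤
      |(1 - |t - 1 / M| / (1 / (4 * (M : ℝ) ^ 2))) - (1 - |t' - 1 / M| / (1 / (4 * (M : ℝ) ^ 2)))| := by
    rw [max_comm (0:ℝ), max_comm (0:ℝ)]
    exact abs_max_sub_max_le_abs _ _ _
  have h2 : |(1 - |t - 1 / M| / (1 / (4 * (M : ℝ) ^ 2))) - (1 - |t' - 1 / M| / (1 / (4 * (M : ℝ) ^ 2)))| ≤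
      4 * (M : ℝ) ^ 2 * |t - t'| := by
    have hW : (0 : ℝ) < 1 / (4 * (M : ℝ) ^ 2) := by positivity
    rw [show (1 - |t - 1 / M| / (1 / (4 * (M : ℝ) ^ 2))) - (1 - |t' - 1 / M| / (1 / (4 * (M : ℝ) ^ 2))) =
      (|t' - 1 / M| - |t - 1 / M|) / (1 / (4 * (M : ℝ) ^ 2)) by ring]
    rw [abs_div, abs_of_pos hW, div_le_iff₀ hW]
    calc |(|t' - 1 / M| - |t - 1 / M|)| ≤ |(t' - 1 / M) - (t - 1 / M)| := abs_abs_sub_abs_le_abs_sub _ _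
      _ = |t - t'| := by rw [abs_sub_comm]; ring_nf
      _ = 4 * (M : ℝ) ^ 2 * |t - t'| * (1 / (4 * (M : ℝ) ^ 2)) := by field_simp
  calc 1 / (4 * (M : ℝ)) * |max 0 (1 - |t - 1 / ↑M| / (1 / (4 * ↑M ^ 2))) - max 0 (1 - |t' - 1 / ↑M| / (1 / (4 * ↑M ^ 2)))|
      ≤ 1 / (4 * (M : ℝ)) * (4 * (M : ℝ) ^ 2 * |t - t'|) :=
        mul_le_mul_of_nonneg_left (h1.trans h2) (by positivity)
    _ = M * |t - t'| := by field_simp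

/-- The tent is continuous. [folklore] -/
theorem continuous_tent (M : ℕ) : Continuous (tent M) := by
  unfold tent
  exact continuous_const.mul (continuous_const.max (continuous_const.sub
    ((continuous_abs.comp (continuous_id.sub continuous_const)).div_const _)))

/-- The tent as an element of `ConvFun`. [folklore] -/
def tentFun (M : ℕ) (hM : 0 < M) : ConvFun :=
  ConvFun.mk (fun t => ((tent M t : ℝ) : ℂ)) (Complex.continuous_ofReal.comp (continuous_tent M))
    (HasCompactSupport.intro (K := Set.Icc (1 / (M : ℝ) - 1 / (4 * (M : ℝ) ^ 2)) (1 / M + 1 / (4 * (M : ℝ) ^ 2)))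
      isCompact_Icc fun t ht => by
      rw [Set.mem_Icc, not_and_or, not_le, not_le] at ht
      rw [tent_eq_zero hM (ht.elim Or.inl Or.inr), Complex.ofReal_zero])

/-- Unfolding `tentFun`. [folklore] -/
theorem tentFun_apply (M : ℕ) (hM : 0 < M) (t : ℝ) : tentFun M hM t = ((tent M t : ℝ) : ℂ) := rfl

/-- **The concrete data of the construction for a given `M ≥ 2`.** [folklore] -/
def tentBump (M : ℕ) (hM : 2 ≤ M) : Bump where
  M := M
  w := 1 / (4 * (M : ℝ) ^ 2)
  Φ := tentFun M (by omega)
  K := M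
  two_le := hM
  w_pos := by positivity
  w_le := le_rfl
  supp := fun t ht => by
    have : tent M t ≠ 0 := by
      intro h; apply ht; rw [tentFun_apply, h, Complex.ofReal_zero]
    exact tent_supp (by omega) this
  isReal := fun t => by rw [tentFun_apply, Complex.ofReal_im]
  nonneg := fun t => by rw [tentFun_apply, Complex.ofReal_re]; exact tent_nonneg M t
  pos := by
    rw [tentFun_apply, Complex.ofReal_re, tent_center]; positivity
  norm_le := fun t => by
    rw [tentFun_apply, Complex.norm_real, Real.norm_eq_abs, abs_of_nonneg (tent_nonneg M t)]
    exact tent_le M t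
  lip := fun t t' => by
    rw [tentFun_apply, tentFun_apply, ← Complex.ofReal_sub, Complex.norm_real, Real.norm_eq_abs]
    exact tent_lip M t t'

/-! ### Choosing the number of blocks -/

/-- For `ν < 1` there is `M ≥ 2` with `1/M + 1/(4M²) < 1 − ν`. [folklore] -/
theorem exists_M {ν : ℝ} (hν1 : ν < 1) : ∃ M : ℕ, 2 ≤ M ∧ 1 / (M : ℝ) + 1 / (4 * (M : ℝ) ^ 2) < 1 - ν := by
  refine ⟨⌈4 / (1 - ν)⌉₊ + 2, by omega, ?_⟩
  set M : ℕ := ⌈4 / (1 - ν)⌉₊ + 2 with hM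
  have hν : 0 < 1 - ν := by linarith
  have hM1 : 4 / (1 - ν) ≤ (M : ℝ) := by
    rw [hM]; push_cast
    have := Nat.le_ceil (4 / (1 - ν)); linarith
  have hM0 : (0 : ℝ) < M := (div_pos (by norm_num) hν).trans_le hM1
  have hM2 : (1 : ℝ) ≤ M := by rw [hM]; push_cast; linarith [Nat.cast_nonneg (α := ℝ) (⌈4 / (1 - ν)⌉₊)]
  have h1 : 1 / (M : ℝ) ≤ (1 - ν) / 4 := by
    rw [div_le_div_iff₀ hM0 (by norm_num)]
    rw [div_le_iff₀ hν] at hM1; linarith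
  have h2 : 1 / (4 * (M : ℝ) ^ 2) ≤ 1 / (M : ℝ) := by
    apply div_le_div_of_nonneg_left zero_le_one hM0; nlinarith
  linarith

/-! ### The integer window `I = (x, x + xη] ∩ ℤ`: size and multiples -/

/-- `|K − xη| ≤ 1` for `K = |(x, x+xη] ∩ ℤ|`, `x ≥ 0`. [folklore] -/
theorem abs_card_sub_le {x η : ℝ} (hx : 0 ≤ x) (hη : 0 ≤ η) :
    |((Finset.Ioc ⌊x⌋₊ ⌊x + x * η⌋₊).card : ℝ) - x * η| ≤ 1 := by
  have hle : ⌊x⌋₊ ≤ ⌊x + x * η⌋₊ := Nat.floor_le_floor (by nlinarith)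
  rw [Nat.card_Ioc, Nat.cast_sub hle]
  have h1 : (⌊x + x * η⌋₊ : ℝ) ≤ x + x * η := Nat.floor_le (by positivity)
  have h2 : x + x * η < (⌊x + x * η⌋₊ : ℝ) + 1 := Nat.lt_floor_add_one _
  have h3 : (⌊x⌋₊ : ℝ) ≤ x := Nat.floor_le hx
  have h4 : x < (⌊x⌋₊ : ℝ) + 1 := Nat.lt_floor_add_one _
  rw [abs_le]; constructor <;> linarith

/-- `|#{n ∈ (a, b] : d ∣ n} − (b − a)/d| ≤ 1` for `a ≤ b`, `d ≥ 1`. [folklore] -/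
theorem abs_card_multiples_sub_le {a b d : ℕ} (hab : a ≤ b) (hd : 0 < d) :
    |((((Finset.Ioc a b).filter (fun m => d ∣ m)).card : ℕ) : ℝ) - ((b : ℝ) - a) / d| ≤ 1 := by
  rw [card_multiples_Ioc a b d hab]
  have hd' : (0 : ℝ) < d := by exact_mod_cast hd
  have hle : a / d ≤ b / d := Nat.div_le_div_right hab
  rw [Nat.cast_sub hle]
  have hb1 : ((b / d : ℕ) : ℝ) ≤ (b : ℝ) / d := Nat.cast_div_le (α := ℝ)
  have hb2 : (b : ℝ) / d - 1 < ((b / d : ℕ) : ℝ) := by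
    have h := Nat.lt_div_mul_add hd (a := b)
    have h' : (b : ℝ) < ((b / d : ℕ) : ℝ) * d + d := by exact_mod_cast h
    rw [div_sub_one hd'.ne', div_lt_iff₀ hd']; linarith
  have ha1 : ((a / d : ℕ) : ℝ) ≤ (a : ℝ) / d := Nat.cast_div_le (α := ℝ)
  have ha2 : (a : ℝ) / d - 1 < ((a / d : ℕ) : ℝ) := by
    have h := Nat.lt_div_mul_add hd (a := a)
    have h' : (a : ℝ) < ((a / d : ℕ) : ℝ) * d + d := by exact_mod_cast h
    rw [div_sub_one hd'.ne', div_lt_iff₀ hd']; linarith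
  rw [sub_div, abs_le]; constructor <;> linarith

/-! ### Window bookkeeping: `K ≥ xη/2`, `Kη ≥ 2x^{1−ϖ}` for large `x` -/

/-- For `x` large (`log x ≥ (4c₁/ϖ)²`, `log x ≥ 4/ϖ`, `x ≥ e`): `x^ϖ η² ≥ 4`, hence `xη² ≥ 4`,
`K ≥ xη/2`, `Kη ≥ 1` and `Kη ≥ 2x^{1−ϖ}` for the window size `K`. [folklore] -/
theorem window_facts {c₁ ϖ x : ℝ} (hc₁ : 0 < c₁) (hϖ0 : 0 < ϖ) (hϖ1 : ϖ ≤ 1) (hxe : Real.exp 1 ≤ x)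
    (hxa : Real.exp ((4 * c₁ / ϖ) ^ 2) ≤ x) (hxb : Real.exp (4 / ϖ) ≤ x) :
    let η := eta c₁ x
    let K : ℝ := ((Finset.Ioc ⌊x⌋₊ ⌊x + x * η⌋₊).card : ℝ)
    x * η / 2 ≤ K ∧ 1 ≤ K * η ∧ 2 * x ^ (1 - ϖ) ≤ K * η ∧ |K - x * η| ≤ 1 := by
  intro η K
  have hx1 : 1 < x := lt_of_lt_of_le (by have := Real.add_one_le_exp (1:ℝ); linarith) hxe
  have hx0 : 0 < x := by linarith
  have hη0 : 0 < η := eta_pos c₁ x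
  have hη1 : η ≤ 1 := eta_le_one hc₁.le x
  have hK : |K - x * η| ≤ 1 := abs_card_sub_le hx0.le hη0.le
  -- `x^ϖ η² ≥ 4`
  have h1 : 1 ≤ η ^ 2 * x ^ (ϖ / 2) :=
    Bump.one_le_eta_sq_mul_rpow (by positivity) hx1 (by
      have := Bump.le_log_of_exp_le hxa
      calc (2 * c₁ / (ϖ / 2)) ^ 2 = (4 * c₁ / ϖ) ^ 2 := by ring
        _ ≤ Real.log x := this)
  have h2 : 4 ≤ x ^ (ϖ / 2) := by
    have hL := Bump.le_log_of_exp_le hxb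
    rw [Real.rpow_def_of_pos hx0]
    have h3 : Real.log 4 ≤ Real.log x * (ϖ / 2) := by
      have h4 : Real.log 4 ≤ 2 := by
        have : Real.log 4 = 2 * Real.log 2 := by
          rw [show (4 : ℝ) = 2 ^ 2 by norm_num, Real.log_pow]; norm_num
        rw [this]; have := Real.log_two_lt_d9; linarith
      rw [div_le_iff₀ hϖ0] at hL
      nlinarith
    calc (4 : ℝ) = Real.exp (Real.log 4) := (Real.exp_log (by norm_num)).symm
      _ ≤ Real.exp (Real.log x * (ϖ / 2)) := Real.exp_le_exp.mpr h3
  have h5 : 4 ≤ x ^ ϖ * η ^ 2 := by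
    have : x ^ ϖ = x ^ (ϖ / 2) * x ^ (ϖ / 2) := by rw [← Real.rpow_add hx0]; ring_nf
    rw [this]
    have := mul_le_mul h2 h1 zero_le_one (Real.rpow_pos_of_pos hx0 _).le
    nlinarith [Real.rpow_pos_of_pos hx0 (ϖ / 2)]
  have hxϖ : x ^ (1 - ϖ) * x ^ ϖ = x := by
    rw [← Real.rpow_add hx0]; norm_num
  have hx1ϖ : 1 ≤ x ^ (1 - ϖ) := Real.one_le_rpow hx1.le (by linarith)
  have h6 : 4 * x ^ (1 - ϖ) ≤ x * η ^ 2 := by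
    calc 4 * x ^ (1 - ϖ) ≤ (x ^ ϖ * η ^ 2) * x ^ (1 - ϖ) := by
          exact mul_le_mul_of_nonneg_right h5 (by positivity)
      _ = x * η ^ 2 := by rw [mul_comm, ← mul_assoc, hxϖ]
  have h7 : 4 ≤ x * η ^ 2 := le_trans (by linarith) h6
  have hKlow : x * η - 1 ≤ K := by linarith [(abs_le.mp hK).1]
  refine ⟨?_, ?_, ?_, hK⟩
  · nlinarith
  · nlinarith
  · nlinarith

namespace Bump

variable (B : Bump)

/-- **(2.4) assembled**: with `a_n = 1 + σ(−1)^{M+1} Re B(n)`,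
`|∑_{n ∈ I, d ∣ n} a_n − K/d| ≤ C (K/d) η` for `1 ≤ d ≤ x^{1−ϖ}`, `x` large. [cite: Ford2004, §2 (2.4)] -/
theorem typeI_final {c C : ℝ} (hc : 0 < c)
    (hPNT : ∀ u : ℝ, 2 ≤ u → |θ u - u| ≤ C * u / Real.exp (c * Real.sqrt (Real.log u)))
    {c₁ : ℝ} (hc₁ : 0 < c₁) (hc₁' : c₁ ≤ c * Real.sqrt B.ε / 4) {ϖ : ℝ} (hϖ : 1 / B.M + B.w < ϖ)
    (hϖ1 : ϖ ≤ 1) :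
    ∃ C' x₀ : ℝ, ∀ x : ℝ, x₀ ≤ x → ∀ σ : ℝ, (σ = 1 ∨ σ = -1) → ∀ d : ℕ, 1 ≤ d → (d : ℝ) ≤ x ^ (1 - ϖ) →
      |(∑ n ∈ (Finset.Ioc ⌊x⌋₊ ⌊x + x * eta c₁ x⌋₊).filter (fun n => d ∣ n),
          (1 + σ * (-1) ^ (B.M + 1) * (B.Bfun x n).re)) -
        ((Finset.Ioc ⌊x⌋₊ ⌊x + x * eta c₁ x⌋₊).card : ℝ) / d| ≤
      C' * ((((Finset.Ioc ⌊x⌋₊ ⌊x + x * eta c₁ x⌋₊).card : ℝ) / d) * eta c₁ x) := by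
  obtain ⟨CA, xA, hA⟩ := B.typeI_bound hc hPNT hc₁ hc₁' hϖ
  have hϖ0 : 0 < ϖ := lt_trans (by have := B.w_pos; have := B.M_pos; positivity) hϖ
  have hCA : 0 ≤ CA := by
    -- from the bound at a point (norms are non-negative)
    have h := hA (max xA (Real.exp 1)) (le_max_left _ _) 1 le_rfl (by
      simp only [Nat.cast_one]
      exact Real.one_le_rpow (le_trans (by have := Real.add_one_le_exp (1:ℝ); linarith) (le_max_right _ _)) (by linarith))
    have h2 : 0 < max xA (Real.exp 1) / (1 : ℕ) * eta c₁ (max xA (Real.exp 1)) ^ 2 := by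
      rw [Nat.cast_one, div_one]
      exact mul_pos (lt_of_lt_of_le (Real.exp_pos 1) (le_max_right _ _)) (pow_pos (eta_pos _ _) 2)
    by_contra hneg
    push Not at hneg
    have : CA * (max xA (Real.exp 1) / (1 : ℕ)) * eta c₁ (max xA (Real.exp 1)) ^ 2 < 0 := by
      rw [mul_assoc]; exact mul_neg_of_neg_of_pos hneg h2
    linarith [norm_nonneg (B.Tsum c₁ (max xA (Real.exp 1)) 1)]
  refine ⟨1 + 2 * CA, max xA (max (Real.exp 1) (max (Real.exp ((4 * c₁ / ϖ) ^ 2)) (Real.exp (4 / ϖ)))),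
    fun x hx σ hσ d hd1 hdx => ?_⟩
  rw [max_le_iff, max_le_iff, max_le_iff] at hx
  obtain ⟨hxA, hxe, hxa, hxb⟩ := hx
  obtain ⟨hKx, hKη, hKd, hK1⟩ := window_facts hc₁ hϖ0 hϖ1 hxe hxa hxb
  set η := eta c₁ x with hη
  set I := Finset.Ioc ⌊x⌋₊ ⌊x + x * η⌋₊ with hI
  set K : ℝ := (I.card : ℝ) with hKdef
  have hx0 : 0 < x := lt_of_lt_of_le (Real.exp_pos 1) hxe
  have hη0 : 0 < η := eta_pos c₁ x
  have hd0 : (0 : ℝ) < d := by exact_mod_cast hd1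
  have hσ1 : |σ| = 1 := by rcases hσ with rfl | rfl <;> simp
  -- split the sum
  have hsplit : ∑ n ∈ I.filter (fun n => d ∣ n), (1 + σ * (-1) ^ (B.M + 1) * (B.Bfun x n).re) =
      ((I.filter (fun n => d ∣ n)).card : ℝ) + σ * (-1) ^ (B.M + 1) * (B.Tsum c₁ x d).re := by
    rw [Finset.sum_add_distrib, Finset.sum_const, nsmul_eq_mul, mul_one, Bump.Tsum, Complex.re_sum,
      Finset.mul_sum]
  rw [hsplit]
  -- the count of multiples
  have hle : ⌊x⌋₊ ≤ ⌊x + x * η⌋₊ := Nat.floor_le_floor (by nlinarith)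
  have hcount : |((I.filter (fun n => d ∣ n)).card : ℝ) - K / d| ≤ 1 := by
    have := abs_card_multiples_sub_le hle hd1 (a := ⌊x⌋₊) (b := ⌊x + x * η⌋₊) (d := d)
    rw [hKdef, hI, Nat.card_Ioc, Nat.cast_sub hle]
    exact this
  have hT : |σ * (-1) ^ (B.M + 1) * (B.Tsum c₁ x d).re| ≤ CA * (x / d) * η ^ 2 := by
    rw [abs_mul, abs_mul, hσ1, one_mul, abs_pow, abs_neg, abs_one, one_pow, one_mul]
    exact (Complex.abs_re_le_norm _).trans (hA x hxA d hd1 hdx)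
  -- `K/d · η` dominates both `1` and `(x/d) η²`
  have hdom1 : 1 ≤ K / d * η := by
    rw [div_mul_eq_mul_div, le_div_iff₀ hd0]; linarith
  have hdom2 : x / d * η ^ 2 ≤ 2 * (K / d * η) := by
    rw [div_mul_eq_mul_div, div_mul_eq_mul_div, ← mul_div_assoc, div_le_div_iff_of_pos_right hd0]
    nlinarith
  calc |((I.filter (fun n => d ∣ n)).card : ℝ) + σ * (-1) ^ (B.M + 1) * (B.Tsum c₁ x d).re - K / d|
      = |(((I.filter (fun n => d ∣ n)).card : ℝ) - K / d) + σ * (-1) ^ (B.M + 1) * (B.Tsum c₁ x d).re| := by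
        ring_nf
    _ ≤ 1 + CA * (x / d) * η ^ 2 := (abs_add_le _ _).trans (add_le_add hcount hT)
    _ ≤ K / d * η + CA * (2 * (K / d * η)) := by
        refine add_le_add hdom1 ?_
        rw [mul_assoc]; exact mul_le_mul_of_nonneg_left hdom2 hCA
    _ = (1 + 2 * CA) * (K / d * η) := by ring

/-- **(2.5) assembled** (perturbation form): for `k ≥ 1` and `x` large,
`|∑_{n ∈ I} (a_n − 1) Λ_k(n) − σ Z_k K (log x)^{k−1}| ≤ C_k K (log x)^{k−1} η`. [cite: Ford2004, §2 (2.5), §3 (3.12)–(3.13)] -/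
theorem lambda_final {c C : ℝ} (hc : 0 < c)
    (hPNT : ∀ u : ℝ, 2 ≤ u → |θ u - u| ≤ C * u / Real.exp (c * Real.sqrt (Real.log u)))
    {c₁ : ℝ} (hc₁ : 0 < c₁) (hc₁' : c₁ ≤ c * Real.sqrt B.ε / 4) {k : ℕ} (hk : 1 ≤ k) :
    ∃ Ck xk : ℝ, ∀ x : ℝ, xk ≤ x → ∀ σ : ℝ, (σ = 1 ∨ σ = -1) →
      |(∑ n ∈ Finset.Ioc ⌊x⌋₊ ⌊x + x * eta c₁ x⌋₊,
          (σ * (-1) ^ (B.M + 1) * (B.Bfun x n).re) * generalizedVonMangoldt k n) -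
        σ * B.Zk k * ((Finset.Ioc ⌊x⌋₊ ⌊x + x * eta c₁ x⌋₊).card : ℝ) * Real.log x ^ (k - 1)| ≤
      (2 * Ck + B.Zk k) * ((Finset.Ioc ⌊x⌋₊ ⌊x + x * eta c₁ x⌋₊).card : ℝ) *
        Real.log x ^ (k - 1) * eta c₁ x := by
  obtain ⟨Ck, xk, hE⟩ := B.lambdaK_est hc hPNT hc₁ hc₁' hk
  refine ⟨Ck, max xk (max (Real.exp 1) (max (Real.exp ((4 * c₁ / 1) ^ 2)) (Real.exp (4 / 1)))),
    fun x hx σ hσ => ?_⟩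
  rw [max_le_iff, max_le_iff, max_le_iff] at hx
  obtain ⟨hxk, hxe, hxa, hxb⟩ := hx
  obtain ⟨hKx, hKη, _, hK1⟩ := window_facts (ϖ := 1) hc₁ one_pos le_rfl hxe hxa hxb
  set η := eta c₁ x with hη
  set I := Finset.Ioc ⌊x⌋₊ ⌊x + x * η⌋₊ with hI
  set K : ℝ := (I.card : ℝ) with hKdef
  set L := Real.log x with hL
  have hx1 : 1 < x := lt_of_lt_of_le (by have := Real.add_one_le_exp (1:ℝ); linarith) hxe
  have hL0 : 0 < L := Real.log_pos hx1
  have hη0 : 0 < η := eta_pos c₁ x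
  have hσ1 : |σ| = 1 := by rcases hσ with rfl | rfl <;> simp
  have hZ := (B.Zk_pos k).le
  -- the sum is `σ s Re(LamSum)`
  have hsum : ∑ n ∈ I, (σ * (-1) ^ (B.M + 1) * (B.Bfun x n).re) * generalizedVonMangoldt k n =
      σ * (-1) ^ (B.M + 1) * (B.LamSum c₁ x k).re := by
    rw [Bump.LamSum, Complex.re_sum, Finset.mul_sum]
    refine Finset.sum_congr rfl fun n _ => ?_
    rw [Complex.re_ofReal_mul]; ring
  rw [hsum]
  -- the real part of the estimate
  have hre : |(B.LamSum c₁ x k).re - (-1) ^ (B.M - 1) * B.Zk k * (x * η) * L ^ (k - 1)| ≤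
      Ck * x * η ^ 2 * L ^ (k - 1) := by
    have h := hE x hxk
    have h2 := Complex.abs_re_le_norm (B.LamSum c₁ x k -
      (((-1 : ℝ) ^ (B.M - 1) * B.Zk k * (x * eta c₁ x) * Real.log x ^ (k - 1) : ℝ) : ℂ))
    rw [Complex.sub_re, Complex.ofReal_re] at h2
    exact h2.trans h
  -- signs: `(−1)^{M+1} (−1)^{M−1} = 1`
  have hsign : (-1 : ℝ) ^ (B.M + 1) * (-1) ^ (B.M - 1) = 1 := by
    rw [← pow_add, show B.M + 1 + (B.M - 1) = 2 * B.M by have := B.two_le; omega, pow_mul]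
    norm_num
  have hkey : σ * (-1) ^ (B.M + 1) * (B.LamSum c₁ x k).re - σ * B.Zk k * K * L ^ (k - 1) =
      σ * (-1) ^ (B.M + 1) * ((B.LamSum c₁ x k).re - (-1) ^ (B.M - 1) * B.Zk k * (x * η) * L ^ (k - 1)) +
        σ * B.Zk k * L ^ (k - 1) * (x * η - K) := by
    have : σ * (-1) ^ (B.M + 1) * ((-1) ^ (B.M - 1) * B.Zk k * (x * η) * L ^ (k - 1)) =
        σ * B.Zk k * (x * η) * L ^ (k - 1) := by
      calc _ = σ * ((-1 : ℝ) ^ (B.M + 1) * (-1) ^ (B.M - 1)) * B.Zk k * (x * η) * L ^ (k - 1) := by ring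
        _ = _ := by rw [hsign]; ring
    linear_combination this
  rw [hkey]
  have hLk : 0 ≤ L ^ (k - 1) := pow_nonneg hL0.le _
  calc |σ * (-1) ^ (B.M + 1) * ((B.LamSum c₁ x k).re - (-1) ^ (B.M - 1) * B.Zk k * (x * η) * L ^ (k - 1)) +
        σ * B.Zk k * L ^ (k - 1) * (x * η - K)|
      ≤ |σ * (-1) ^ (B.M + 1) * ((B.LamSum c₁ x k).re - (-1) ^ (B.M - 1) * B.Zk k * (x * η) * L ^ (k - 1))| +
        |σ * B.Zk k * L ^ (k - 1) * (x * η - K)| := abs_add_le _ _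
    _ ≤ Ck * x * η ^ 2 * L ^ (k - 1) + B.Zk k * L ^ (k - 1) * 1 := by
        refine add_le_add ?_ ?_
        · rw [abs_mul, abs_mul, hσ1, one_mul, abs_pow, abs_neg, abs_one, one_pow, one_mul]
          exact hre
        · rw [abs_mul, abs_mul, abs_mul, hσ1, one_mul, abs_of_nonneg hZ, abs_of_nonneg hLk, abs_sub_comm]
          exact mul_le_mul_of_nonneg_left hK1 (by positivity)
    _ ≤ Ck * (2 * K * η) * L ^ (k - 1) + B.Zk k * L ^ (k - 1) * (K * η) := by
        have hCk : 0 ≤ Ck * L ^ (k - 1) := by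
          -- `Ck ≥ 0` is not assumed; but the bound `hre` at this `x` forces the term to be ≥ |..| ≥ 0
          have : 0 ≤ Ck * x * η ^ 2 * L ^ (k - 1) := (abs_nonneg _).trans hre
          have hpos : 0 < x * η ^ 2 := by positivity
          by_contra hneg
          push Not at hneg
          have : Ck * x * η ^ 2 * L ^ (k - 1) = (Ck * L ^ (k - 1)) * (x * η ^ 2) := by ring
          nlinarith
        have h1 : Ck * x * η ^ 2 * L ^ (k - 1) ≤ Ck * (2 * K * η) * L ^ (k - 1) := by
          have : x * η ^ 2 ≤ 2 * K * η := by nlinarith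
          calc Ck * x * η ^ 2 * L ^ (k - 1) = (Ck * L ^ (k - 1)) * (x * η ^ 2) := by ring
            _ ≤ (Ck * L ^ (k - 1)) * (2 * K * η) := mul_le_mul_of_nonneg_left this hCk
            _ = Ck * (2 * K * η) * L ^ (k - 1) := by ring
        have h2 : B.Zk k * L ^ (k - 1) * 1 ≤ B.Zk k * L ^ (k - 1) * (K * η) :=
          mul_le_mul_of_nonneg_left hKη (by positivity)
        exact add_le_add h1 h2
    _ = (2 * Ck + B.Zk k) * K * L ^ (k - 1) * η := by ring

end Bump

end Ford2004

open Ford2004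

/-- **[Ford2004] Theorem 3 with the choice of `f_{1_M}` of the proof of Theorem 1 — the local
construction (2.3)–(2.5) on one interval `I = (x, x + x e^{−c₁√log x}]`: DISCHARGE of the named
fact `Ford2004_localConstruction`.** Given `ν ∈ (0, 1)`: take `M ≥ 2` with
`1/M + 1/(4M²) < 1 − ν` (`exists_M`), the tent bump at `1/M` (`tentBump`), `ϖ` strictly between
`1/M + w` and `1 − ν`, the constants `c, C` of the prime number theorem with the de la Vallée
Poussin error term (the tree's PROVED `ChebyshevThetaDeLaValleePoussin_holds`), `c₁ = c√ε/4`,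
`θ_k = Z_k > 0` (`Bump.Zk_pos`), and `a_n = 1 + σ (−1)^{M+1} Re B(n)` (`Bump.Bfun`,
`|B(n)| ≤ 1`); then (2.4) is `Bump.typeI_final` and (2.5) is `Bump.lambda_final`.
[cite: Ford2004, Theorem 3 and §2 (2.3)–(2.5)] -/
theorem Ford2004_localConstruction_holds : Ford2004_localConstruction := by
  intro ν hν0 hν1
  obtain ⟨M, hM2, hMν⟩ := exists_M hν1
  set B : Bump := tentBump M hM2 with hB
  have hBM : B.M = M := rfl
  have hBw : B.w = 1 / (4 * (M : ℝ) ^ 2) := rfl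
  -- the level exponent `ϖ`
  set ϖ : ℝ := (1 / (M : ℝ) + 1 / (4 * (M : ℝ) ^ 2) + (1 - ν)) / 2 with hϖdef
  have hϖlo : 1 / B.M + B.w < ϖ := by rw [hBM, hBw, hϖdef]; linarith
  have hϖν : ϖ < 1 - ν := by rw [hϖdef]; linarith
  have hM0 : (0 : ℝ) < M := by exact_mod_cast lt_of_lt_of_le (by norm_num) hM2
  have hϖ0 : 0 < ϖ := by rw [hϖdef]; positivity
  have hϖ1 : ϖ ≤ 1 := by linarith
  -- the prime number theorem
  obtain ⟨c, hc, C, hPNT⟩ := Literature.NumberTheory.LFunctions.ChebyshevThetaDeLaValleePoussin_holds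
  set c₁ : ℝ := c * Real.sqrt B.ε / 4 with hc₁def
  have hc₁ : 0 < c₁ := by
    rw [hc₁def]; have := Real.sqrt_pos.mpr B.ε_pos; positivity
  have hc₁' : c₁ ≤ c * Real.sqrt B.ε / 4 := le_rfl
  -- the two estimates
  obtain ⟨C', x₀', hI⟩ := B.typeI_final hc hPNT hc₁ hc₁' hϖlo hϖ1
  have key : ∀ k : ℕ, ∃ Ck xk : ℝ, (1 ≤ k → ∀ x : ℝ, xk ≤ x → ∀ σ : ℝ, (σ = 1 ∨ σ = -1) →
      |(∑ n ∈ Finset.Ioc ⌊x⌋₊ ⌊x + x * eta c₁ x⌋₊,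
          (σ * (-1) ^ (B.M + 1) * (B.Bfun x n).re) * generalizedVonMangoldt k n) -
        σ * B.Zk k * ((Finset.Ioc ⌊x⌋₊ ⌊x + x * eta c₁ x⌋₊).card : ℝ) * Real.log x ^ (k - 1)| ≤
      (2 * Ck + B.Zk k) * ((Finset.Ioc ⌊x⌋₊ ⌊x + x * eta c₁ x⌋₊).card : ℝ) *
        Real.log x ^ (k - 1) * eta c₁ x) := by
    intro k
    rcases Nat.eq_zero_or_pos k with rfl | hk
    · exact ⟨0, 0, fun h => absurd h (by norm_num)⟩
    · obtain ⟨Ck, xk, h⟩ := B.lambda_final hc hPNT hc₁ hc₁' (k := k) hk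
      exact ⟨Ck, xk, fun _ => h⟩
  choose Ck xk hL using key
  refine ⟨ϖ, hϖ0, hϖν, c₁, hc₁, fun k => B.Zk k, fun k _ => B.Zk_pos k, C',
    fun k => 2 * Ck k + B.Zk k, xk, x₀', fun x hx σ hσ => ?_⟩
  refine ⟨fun n => 1 + σ * (-1) ^ (B.M + 1) * (B.Bfun x n).re, ?_, ?_, ?_⟩
  · -- (2.3): `0 ≤ a_n ≤ 2`
    intro n
    have h1 : |σ * (-1) ^ (B.M + 1) * (B.Bfun x n).re| ≤ 1 := by
      have hσ1 : |σ| = 1 := by rcases hσ with rfl | rfl <;> simp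
      rw [abs_mul, abs_mul, hσ1, one_mul, abs_pow, abs_neg, abs_one, one_pow, one_mul]
      exact (Complex.abs_re_le_norm _).trans (B.norm_Bfun_le x n)
    rw [abs_le] at h1
    constructor <;> linarith [h1.1, h1.2]
  · -- (2.4)
    intro d hd1 hdx
    have h := hI x hx σ hσ d hd1 hdx
    rw [← mul_assoc] at h
    exact h
  · -- (2.5)
    intro k hk hxk
    have h := hL k hk x hxk σ hσ
    have hrew : ∑ n ∈ Finset.Ioc ⌊x⌋₊ ⌊x + x * eta c₁ x⌋₊,
        (1 + σ * (-1) ^ (B.M + 1) * (B.Bfun x n).re - 1) * generalizedVonMangoldt k n =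
        ∑ n ∈ Finset.Ioc ⌊x⌋₊ ⌊x + x * eta c₁ x⌋₊,
          (σ * (-1) ^ (B.M + 1) * (B.Bfun x n).re) * generalizedVonMangoldt k n :=
      Finset.sum_congr rfl fun n _ => by ring
    rw [hrew]
    exact h

end Literature.NumberTheory.Sieve
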